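import Summits.BirchSwinnertonDyer.BirchSwinnertonDyer.Theorems.GenusKolyvaginAtTwoPowDvdShaCardAtTwoRTLostBitLaw
import Literature.NumberTheory.EllipticCurves.HeegnerPointsKolyvaginPrimaryProp82Proofs
import HarnessLib

/-!
# Route `GenusKolyvaginAtTwo`, crux L_T `PowDvdShaCardAtTwoRT` (stmt-BirchSwinnertonDyer-23242), LINE 18 stub 3a⁗ —
# the lost-bit law INSTANTIATED: the Weil pairing `e_{2^M}` on `E[2^M]` with complex conjugation, on `Δ(E) < 0`

LEAD seat `bsd-line-gk2-p1` g15 (cell `bsd-f1-sign2`), `--supports stmt-BirchSwinnertonDyer-23242` (helper). THEOREMS ONLY; BSD is not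
proved by this file; neither is the crux or the stub.

The abstract law (`lostBit_orderOf_pairing_fixed_antifixed`, `…RTLostBitLaw`, p690522) needs: a free rank-one `ℤ/2^M[C₂]`-module
(`hspan`, `hfree`, `htor`), an involution `τ`, a bi-multiplicative alternating pairing `e` with `e(τS, τT) = e(S,T)⁻¹`, and `e(P₀, τP₀)` of
full order `2^M`. THIS FILE discharges all of them for `A = E[2^M] = geomTorsion W (2^M)` (`W/ℚ` elliptic, `Δ < 0`), `τ = c₀` a complex
conjugation, and ANY Weil-pairing datum `e` in the tree's shape (`WeierstrassCurve.exists_weilPairing`: `hμ`, `hadd₁`, `hadd₂`, `halt`,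
non-degeneracy `hnd`, Galois-equivariance `hgal` — a tree THEOREM, `exists_weilPairing_holds`, Silverman AEC III.8.1):
* `free_of_span_geomTorsion` — route item Q1 `CyclicTorsionOfNegDisc` (spanning, `GenusCyclicTorsion.cyclicTorsionOfNegDisc_proof`) plus
  `#E[2^M] = 4^M` (`card_torsionPoints_eq_sq_holds`) give FREENESS of `(P₀, c₀P₀)` over `ℤ/2^M`;
* `weilPairing_conj_conj_eq_inv` — `e(c₀S, c₀T) = e(S,T)⁻¹`: `hgal` and «`c₀` inverts `μ_{2^M}`»
  (`smul_eq_inv_of_smul_torsion_pow_eq`, Gross (3.3), a tree theorem);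
* `orderOf_weilPairing_generator_eq` — `e(P₀, c₀P₀)` has order exactly `2^M` (non-degeneracy + freeness + alternation);
* **`lostBit_orderOf_weilPairing`** — given the spanning point `P₀` of route item Q1 (`E[2^M] = {aP₀ + b c₀P₀}`, `Δ < 0`,
  `GenusCyclicTorsion.cyclicTorsionOfNegDisc_proof` — taken as a hypothesis so that this file stays off the route cone), for
  `x, y ∈ E[2^M]` with `c₀x = x` of order `2^{N_x}` and `c₀y = −y` of order `2^{N_y}`:
  `orderOf (e x y) = orderOf (e y x) = 2^(N_x + N_y − (M+1))`; and `weilPairing_eq_one_of_same_sign` — same-sign pairs are trivial.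
At a Kolyvagin prime `λ ∣ ℓ` (`Frob_ℓ = c₀` on `E[2^M]`, `ℓ ≡ −1 mod 2^M`) this is the local Tate pairing of the unramified coordinate of
one Kolyvagin class against the transverse coordinate of another in Frobenius coordinates (memo
`Cruxes/PowDvdShaCardAtTwoRT/Lines/plus-descent-lead-g15.md` §2.2–2.3; same statement in the CLASS convention of gk2-p2 g16 (F3):
«τ-fixed parts pair to 2 × perfect, (+) ⟂ (−)»).

References: [SilvermanAEC2009] III.8.1; [GrossLMS1991] §3 (3.3), §4; [McCallumLMS1991] §3, §5 Lemma 5.3, Prop. 4.4.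
-/

set_option autoImplicit false
-- `Summit.<P>.<Sub>` repeats `BirchSwinnertonDyer` by the tree's layout convention (D-0017)
set_option linter.dupNamespace false

noncomputable section

open scoped Classical

namespace Summit.BirchSwinnertonDyer.BirchSwinnertonDyer.Theorems.GenusExact.PlusDescent

open WeierstrassCurve Field Literature.NumberTheory.EllipticCurves Literature.NumberTheory.GaloisRepresentations

variable {W : WeierstrassCurve ℚ} [W.IsElliptic]

/-- **Freeness from spanning.** If `E[2^M] = {aP₀ + b c₀P₀}` (route item Q1 on `Δ < 0`) then `(P₀, c₀P₀)` is FREE over `ℤ/2^M`: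
`aP₀ + b c₀P₀ = 0 ⟹ 2^M ∣ a, b` — a surjection `(ℤ/2^M)² → E[2^M]` between sets of the same size `4^M` is injective.
[cite: SilvermanAEC2009, Cor. III.6.4(b)] [cite: McCallumLMS1991, §3 (the ⟨τ⟩-basis of E[p^M])] -/
theorem free_of_span_geomTorsion {M : ℕ} (c₀ : absoluteGaloisGroup ℚ) {P₀ : geomTorsion W ((2 ^ M : ℕ) : ℤ)}
    (hspan : ∀ Q : geomTorsion W ((2 ^ M : ℕ) : ℤ), ∃ a b : ℤ, Q = a • P₀ + b • (c₀ • P₀)) :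
    ∀ a b : ℤ, a • P₀ + b • (c₀ • P₀) = 0 → (2 ^ M : ℤ) ∣ a ∧ (2 ^ M : ℤ) ∣ b := by
  haveI : NeZero (2 ^ M) := ⟨pow_ne_zero _ two_ne_zero⟩
  have hNP : ∀ Q : geomTorsion W ((2 ^ M : ℕ) : ℤ), ((2 ^ M : ℕ) : ℤ) • Q = 0 := fun Q ↦ by
    apply Subtype.ext
    rw [AddSubgroupClass.coe_zsmul, ZeroMemClass.coe_zero]
    exact (mem_geomTorsion_iff W _ (Q : geomPoints W)).mp Q.2
  -- the counting map
  let g : ZMod (2 ^ M) × ZMod (2 ^ M) → geomTorsion W ((2 ^ M : ℕ) : ℤ) :=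
    fun ab ↦ (ab.1.val : ℤ) • P₀ + (ab.2.val : ℤ) • (c₀ • P₀)
  have hred : ∀ (a : ℤ) (Q : geomTorsion W ((2 ^ M : ℕ) : ℤ)), a • Q = ((a : ZMod (2 ^ M)).val : ℤ) • Q := by
    intro a Q
    have h : ((a : ZMod (2 ^ M)).val : ℤ) = a % ((2 ^ M : ℕ) : ℤ) := by
      rw [ZMod.val_intCast]
    rw [h]
    conv_lhs => rw [← Int.emod_add_mul_ediv a ((2 ^ M : ℕ) : ℤ)]
    rw [add_zsmul, mul_comm, mul_zsmul, hNP, zsmul_zero, add_zero]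
  have hsurj : Function.Surjective g := by
    intro Q
    obtain ⟨a, b, rfl⟩ := hspan Q
    exact ⟨((a : ZMod (2 ^ M)), (b : ZMod (2 ^ M))), by simp only [g]; rw [← hred a, ← hred b]⟩
  have hcardT : Nat.card (geomTorsion W ((2 ^ M : ℕ) : ℤ)) = (2 ^ M) ^ 2 :=
    card_torsionPoints_eq_sq_holds W (AlgebraicClosure ℚ) (n := 2 ^ M) (by exact_mod_cast (NeZero.ne (2 ^ M)))
  haveI : Finite (geomTorsion W ((2 ^ M : ℕ) : ℤ)) := Nat.finite_of_card_ne_zero (by rw [hcardT]; positivity)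
  have hle : Nat.card (ZMod (2 ^ M) × ZMod (2 ^ M)) ≤ Nat.card (geomTorsion W ((2 ^ M : ℕ) : ℤ)) := by
    rw [hcardT, Nat.card_prod, Nat.card_zmod, sq]
  have hinj : Function.Injective g := (hsurj.bijective_of_nat_card_le hle).1
  intro a b hab
  have h0 : g ((a : ZMod (2 ^ M)), (b : ZMod (2 ^ M))) = g (0, 0) := by
    simp only [g, ZMod.val_zero, Nat.cast_zero, zero_zsmul, add_zero]
    rw [← hred a, ← hred b, hab]
  have h := hinj h0
  simp only [Prod.mk.injEq] at h
  refine ⟨?_, ?_⟩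
  · have := (ZMod.intCast_zmod_eq_zero_iff_dvd a (2 ^ M)).mp h.1
    exact_mod_cast this
  · have := (ZMod.intCast_zmod_eq_zero_iff_dvd b (2 ^ M)).mp h.2
    exact_mod_cast this

/-- **Complex conjugation inverts the Weil pairing**: `e(c₀S, c₀T) = e(S,T)⁻¹` for a Galois-equivariant pairing with values in
`μ_{2^M}` (`hgal`, and `c₀ζ = ζ⁻¹` on `μ_{2^M}`, Gross (3.3)). [cite: SilvermanAEC2009, III.8.1 (Galois equivariance)] [cite: GrossLMS1991, §3 (3.3)] -/
theorem weilPairing_conj_conj_eq_inv {M : ℕ} (hM : 1 ≤ M) {c₀ : absoluteGaloisGroup ℚ}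
    (hc₀ : IsComplexConjugation (Rat.castHom ℝ) c₀)
    (e : geomTorsion W ((2 ^ M : ℕ) : ℤ) → geomTorsion W ((2 ^ M : ℕ) : ℤ) → AlgebraicClosure ℚ)
    (hμ : ∀ S T, e S T ^ (2 ^ M) = 1)
    (hgal : ∀ (σ : absoluteGaloisGroup ℚ) (S T : geomTorsion W ((2 ^ M : ℕ) : ℤ)), σ • e S T = e (σ • S) (σ • T))
    (S T : geomTorsion W ((2 ^ M : ℕ) : ℤ)) : e (c₀ • S) (c₀ • T) = (e S T)⁻¹ := by
  rw [← hgal]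
  exact smul_eq_inv_of_smul_torsion_pow_eq W Nat.prime_two hM rfl hc₀ (fun _ ↦ rfl) (hμ S T)

/-- **The basic value has full order.** With `(P₀, c₀P₀)` free over `ℤ/2^M`, a non-degenerate alternating bi-multiplicative pairing has
`e(P₀, c₀P₀)` of order exactly `2^M`: if `e(P₀,c₀P₀)^{2^{M−1}} = 1` then `2^{M−1}c₀P₀` pairs trivially with everything, so it vanishes,
contradicting freeness. [cite: SilvermanAEC2009, III.8.1 (non-degeneracy, alternation)] -/
theorem orderOf_weilPairing_generator_eq {M : ℕ} (hM : 1 ≤ M) (c₀ : absoluteGaloisGroup ℚ) {P₀ : geomTorsion W ((2 ^ M : ℕ) : ℤ)}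
    (hspan : ∀ Q : geomTorsion W ((2 ^ M : ℕ) : ℤ), ∃ a b : ℤ, Q = a • P₀ + b • (c₀ • P₀))
    (e : geomTorsion W ((2 ^ M : ℕ) : ℤ) → geomTorsion W ((2 ^ M : ℕ) : ℤ) → AlgebraicClosure ℚ)
    (hμ : ∀ S T, e S T ^ (2 ^ M) = 1)
    (hadd₁ : ∀ S₁ S₂ T, e (S₁ + S₂) T = e S₁ T * e S₂ T) (hadd₂ : ∀ S T₁ T₂, e S (T₁ + T₂) = e S T₁ * e S T₂)
    (halt : ∀ T, e T T = 1) (hnd : ∀ T, (∀ S, e S T = 1) → T = 0) :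
    orderOf (e P₀ (c₀ • P₀)) = 2 ^ M := by
  haveI : Fact (Nat.Prime 2) := ⟨Nat.prime_two⟩
  have hfree := free_of_span_geomTorsion c₀ hspan
  obtain ⟨n, rfl⟩ : ∃ n, M = n + 1 := ⟨M - 1, by omega⟩
  refine orderOf_eq_prime_pow (fun hpow ↦ ?_) (hμ _ _)
  -- `T₀ := 2^n • c₀P₀` pairs trivially with every `S = aP₀ + b c₀P₀`
  have he2 : ∀ (S T : geomTorsion W ((2 ^ (n + 1) : ℕ) : ℤ)) (k : ℕ), e S (k • T) = e S T ^ k := by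
    intro S T k
    induction k with
    | zero =>
      rw [zero_smul, pow_zero]
      have h := hadd₂ S 0 0
      rw [add_zero] at h
      exact (mul_right_eq_self₀.mp h.symm).resolve_right (by
        intro h0; have := hμ S 0; rw [h0, zero_pow (pow_ne_zero _ two_ne_zero)] at this; exact zero_ne_one this)
    | succ k ih => rw [succ_nsmul, hadd₂, ih, pow_succ]
  have he1 : ∀ (S T : geomTorsion W ((2 ^ (n + 1) : ℕ) : ℤ)) (k : ℤ), e (k • S) T = e S T ^ k := by
    intro S T k
    -- `e (· ) T` is a group hom into the units; use zpow via the `ℕ` case and negation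
    have hnat : ∀ m : ℕ, e (m • S) T = e S T ^ m := by
      intro m
      induction m with
      | zero =>
        rw [zero_smul, pow_zero]
        have h := hadd₁ 0 0 T
        rw [add_zero] at h
        exact (mul_right_eq_self₀.mp h.symm).resolve_right (by
          intro h0; have := hμ 0 T; rw [h0, zero_pow (pow_ne_zero _ two_ne_zero)] at this; exact zero_ne_one this)
      | succ m ih => rw [succ_nsmul, hadd₁, ih, pow_succ]
    have hne : e S T ≠ 0 := fun h0 ↦ by
      have := hμ S T; rw [h0, zero_pow (pow_ne_zero _ two_ne_zero)] at this; exact zero_ne_one this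
    rcases Int.eq_nat_or_neg k with ⟨m, rfl | rfl⟩
    · rw [natCast_zsmul, hnat, zpow_natCast]
    · have hneg : e (-(m : ℤ) • S) T * e ((m : ℤ) • S) T = 1 := by
        rw [← hadd₁, neg_zsmul, neg_add_cancel]
        have h := hadd₁ 0 0 T
        rw [add_zero] at h
        exact (mul_right_eq_self₀.mp h.symm).resolve_right (by
          intro h0; have := hμ 0 T; rw [h0, zero_pow (pow_ne_zero _ two_ne_zero)] at this; exact zero_ne_one this)
      rw [natCast_zsmul, hnat] at hneg
      rw [zpow_neg, zpow_natCast]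
      exact eq_inv_of_mul_eq_one_left hneg
  set T₀ : geomTorsion W ((2 ^ (n + 1) : ℕ) : ℤ) := (2 ^ n) • (c₀ • P₀) with hT₀
  have htriv : ∀ S, e S T₀ = 1 := by
    intro S
    obtain ⟨a, b, rfl⟩ := hspan S
    rw [hadd₁, he1, he1, hT₀, he2, he2, hpow, one_zpow, one_mul, ← he2, ← he1]
    -- `e (b • c₀P₀) (2^n • c₀P₀) = e (c₀P₀) (c₀P₀)^{…} = 1`
    rw [he1, he2, halt, one_pow, one_zpow]
  have hT0 : T₀ = 0 := hnd T₀ htriv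
  -- contradiction with freeness: `0 • P₀ + 2^n • c₀P₀ = 0` would force `2^(n+1) ∣ 2^n`
  have h := (hfree 0 ((2 : ℤ) ^ n) (by rw [zero_zsmul, zero_add, ← natCast_zsmul] at *; exact_mod_cast hT0)).2
  have h' : (2 : ℤ) ^ (n + 1) ≤ (2 : ℤ) ^ n := Int.le_of_dvd (by positivity) (by exact_mod_cast h)
  have h'' : (2 : ℤ) ^ n < (2 : ℤ) ^ (n + 1) := pow_lt_pow_right₀ (by norm_num) (by omega)
  exact absurd h' (not_le.mpr h'')

/-- **THE LOST-BIT LAW FOR THE WEIL PAIRING ON `E[2^M]`.** `W/ℚ` elliptic, `c₀` a complex conjugation with `E[2^M] = ℤP₀ + ℤc₀P₀`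
(route item Q1 on `Δ < 0`), `M ≥ 1`, `e` a Weil-pairing datum on `E[2^M]` (bi-multiplicative, `2^M`-th roots of unity, alternating, non-degenerate, Galois-equivariant —
`WeierstrassCurve.exists_weilPairing_holds`). For `x, y ∈ E[2^M]` with `c₀x = x` of order `2^{N_x}` and `c₀y = −y` of order `2^{N_y}`:
**`orderOf (e x y) = orderOf (e y x) = 2^(N_x + N_y − (M+1))`** — exactly one bit lost. (Route item Q1 supplies the free generator; at a
Kolyvagin prime this is the local Tate pairing of Kolyvagin classes of opposite parity in Frobenius coordinates.)
[cite: SilvermanAEC2009, III.8.1] [cite: McCallumLMS1991, §5 Lemma 5.3, Prop. 4.4] [cite: GrossLMS1991, §3 (3.3)] -/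
theorem lostBit_orderOf_weilPairing {M : ℕ} (hM : 1 ≤ M) {c₀ : absoluteGaloisGroup ℚ}
    (hc₀ : IsComplexConjugation (Rat.castHom ℝ) c₀) {P₀ : geomTorsion W ((2 ^ M : ℕ) : ℤ)}
    (hspan : ∀ Q : geomTorsion W ((2 ^ M : ℕ) : ℤ), ∃ a b : ℤ, Q = a • P₀ + b • (c₀ • P₀))
    (e : geomTorsion W ((2 ^ M : ℕ) : ℤ) → geomTorsion W ((2 ^ M : ℕ) : ℤ) → AlgebraicClosure ℚ)
    (hμ : ∀ S T, e S T ^ (2 ^ M) = 1)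
    (hadd₁ : ∀ S₁ S₂ T, e (S₁ + S₂) T = e S₁ T * e S₂ T) (hadd₂ : ∀ S T₁ T₂, e S (T₁ + T₂) = e S T₁ * e S T₂)
    (halt : ∀ T, e T T = 1) (hnd : ∀ T, (∀ S, e S T = 1) → T = 0)
    (hgal : ∀ (σ : absoluteGaloisGroup ℚ) (S T : geomTorsion W ((2 ^ M : ℕ) : ℤ)), σ • e S T = e (σ • S) (σ • T))
    {x y : geomTorsion W ((2 ^ M : ℕ) : ℤ)} (hx : c₀ • x = x) (hy : c₀ • y = -y) {Nx Ny : ℕ}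
    (hNx : addOrderOf x = 2 ^ Nx) (hNy : addOrderOf y = 2 ^ Ny) :
    orderOf (e x y) = 2 ^ (Nx + Ny - (M + 1)) ∧ orderOf (e y x) = 2 ^ (Nx + Ny - (M + 1)) := by
  -- freeness of the generator (route item Q1 supplies `P₀` on `Δ < 0`: `GenusCyclicTorsion.cyclicTorsionOfNegDisc_proof`)
  have hfree := free_of_span_geomTorsion c₀ hspan
  have htor : (2 ^ M : ℤ) • P₀ = 0 := by
    apply Subtype.ext
    rw [AddSubgroupClass.coe_zsmul, ZeroMemClass.coe_zero]
    have := (mem_geomTorsion_iff W _ (P₀ : geomPoints W)).mp P₀.2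
    exact_mod_cast this
  -- `τ = c₀` as an additive endomorphism, an involution
  set τ : geomTorsion W ((2 ^ M : ℕ) : ℤ) →+ geomTorsion W ((2 ^ M : ℕ) : ℤ) := DistribSMul.toAddMonoidHom _ c₀ with hτdef
  have hτ : ∀ z, τ z = c₀ • z := fun z ↦ rfl
  have hττ : ∀ z, τ (τ z) = z := fun z ↦ by
    rw [hτ, hτ, smul_smul, ← sq, hc₀.sq_eq_one, one_smul]
  -- the pairing lifted to the unit group
  have hne : ∀ S T, e S T ≠ 0 := fun S T h0 ↦ by
    have := hμ S T; rw [h0, zero_pow (pow_ne_zero _ two_ne_zero)] at this; exact zero_ne_one this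
  let e' : geomTorsion W ((2 ^ M : ℕ) : ℤ) → geomTorsion W ((2 ^ M : ℕ) : ℤ) → (AlgebraicClosure ℚ)ˣ :=
    fun S T ↦ Units.mk0 (e S T) (hne S T)
  have he' : ∀ S T, ((e' S T : (AlgebraicClosure ℚ)ˣ) : AlgebraicClosure ℚ) = e S T := fun _ _ ↦ rfl
  have hadd₁' : ∀ S₁ S₂ T, e' (S₁ + S₂) T = e' S₁ T * e' S₂ T := fun _ _ _ ↦ Units.ext (by
    rw [Units.val_mul, he', he', he', hadd₁])
  have hadd₂' : ∀ S T₁ T₂, e' S (T₁ + T₂) = e' S T₁ * e' S T₂ := fun _ _ _ ↦ Units.ext (by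
    rw [Units.val_mul, he', he', he', hadd₂])
  have halt' : ∀ T, e' T T = 1 := fun _ ↦ Units.ext (by rw [he', Units.val_one, halt])
  have hanti' : ∀ S T, e' (τ S) (τ T) = (e' S T)⁻¹ := fun S T ↦ Units.ext (by
    rw [Units.val_inv_eq_inv_val, he', he', hτ, hτ]
    exact weilPairing_conj_conj_eq_inv hM hc₀ e hμ hgal S T)
  have hspan' : ∀ Q : geomTorsion W ((2 ^ M : ℕ) : ℤ), ∃ a b : ℤ, Q = a • P₀ + b • τ P₀ := hspan
  have hfree' : ∀ a b : ℤ, a • P₀ + b • τ P₀ = 0 → (2 ^ M : ℤ) ∣ a ∧ (2 ^ M : ℤ) ∣ b := hfree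
  have hunit' : orderOf (e' P₀ (τ P₀)) = 2 ^ M := by
    rw [← orderOf_units, he', hτ]
    exact orderOf_weilPairing_generator_eq hM c₀ hspan e hμ hadd₁ hadd₂ halt hnd
  have hx' : τ x = x := hx
  have hy' : τ y = -y := hy
  obtain ⟨h1, h2⟩ := lostBit_orderOf_pairing_fixed_antifixed τ hττ e' hadd₁' hadd₂' halt' hanti' P₀ hspan' hfree' htor hunit'
    hx' hy' hNx hNy
  rw [← orderOf_units, he'] at h1 h2
  exact ⟨h1, h2⟩

/-- **Same-sign pairs are trivial** (the companion statement): under the hypotheses of `lostBit_orderOf_weilPairing`, two `c₀`-FIXED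
points, or two `c₀`-ANTI-fixed points, of `E[2^M]` pair to `1`. [cite: McCallumLMS1991, §5 Lemma 5.3] -/
theorem weilPairing_eq_one_of_same_sign {M : ℕ} (hM : 1 ≤ M) {c₀ : absoluteGaloisGroup ℚ}
    (hc₀ : IsComplexConjugation (Rat.castHom ℝ) c₀) {P₀ : geomTorsion W ((2 ^ M : ℕ) : ℤ)}
    (hspan : ∀ Q : geomTorsion W ((2 ^ M : ℕ) : ℤ), ∃ a b : ℤ, Q = a • P₀ + b • (c₀ • P₀))
    (e : geomTorsion W ((2 ^ M : ℕ) : ℤ) → geomTorsion W ((2 ^ M : ℕ) : ℤ) → AlgebraicClosure ℚ)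
    (hμ : ∀ S T, e S T ^ (2 ^ M) = 1)
    (hadd₁ : ∀ S₁ S₂ T, e (S₁ + S₂) T = e S₁ T * e S₂ T) (hadd₂ : ∀ S T₁ T₂, e S (T₁ + T₂) = e S T₁ * e S T₂)
    (hgal : ∀ (σ : absoluteGaloisGroup ℚ) (S T : geomTorsion W ((2 ^ M : ℕ) : ℤ)), σ • e S T = e (σ • S) (σ • T)) :
    (∀ x x' : geomTorsion W ((2 ^ M : ℕ) : ℤ), c₀ • x = x → c₀ • x' = x' → e x x' = 1) ∧
      (∀ y y' : geomTorsion W ((2 ^ M : ℕ) : ℤ), c₀ • y = -y → c₀ • y' = -y' → e y y' = 1) := by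
  have hfree := free_of_span_geomTorsion c₀ hspan
  have htor : (2 ^ M : ℤ) • P₀ = 0 := by
    apply Subtype.ext
    rw [AddSubgroupClass.coe_zsmul, ZeroMemClass.coe_zero]
    have := (mem_geomTorsion_iff W _ (P₀ : geomPoints W)).mp P₀.2
    exact_mod_cast this
  set τ : geomTorsion W ((2 ^ M : ℕ) : ℤ) →+ geomTorsion W ((2 ^ M : ℕ) : ℤ) := DistribSMul.toAddMonoidHom _ c₀ with hτdef
  have hτ : ∀ z, τ z = c₀ • z := fun z ↦ rfl
  have hττ : ∀ z, τ (τ z) = z := fun z ↦ by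
    rw [hτ, hτ, smul_smul, ← sq, hc₀.sq_eq_one, one_smul]
  have hne : ∀ S T, e S T ≠ 0 := fun S T h0 ↦ by
    have := hμ S T; rw [h0, zero_pow (pow_ne_zero _ two_ne_zero)] at this; exact zero_ne_one this
  -- the pairing lifted to the unit group, packaged additively
  let e' : geomTorsion W ((2 ^ M : ℕ) : ℤ) → geomTorsion W ((2 ^ M : ℕ) : ℤ) → (AlgebraicClosure ℚ)ˣ :=
    fun S T ↦ Units.mk0 (e S T) (hne S T)
  have he' : ∀ S T, ((e' S T : (AlgebraicClosure ℚ)ˣ) : AlgebraicClosure ℚ) = e S T := fun _ _ ↦ rfl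
  have hadd₁' : ∀ S₁ S₂ T, e' (S₁ + S₂) T = e' S₁ T * e' S₂ T := fun _ _ _ ↦ Units.ext (by
    rw [Units.val_mul, he', he', he', hadd₁])
  have hadd₂' : ∀ S T₁ T₂, e' S (T₁ + T₂) = e' S T₁ * e' S T₂ := fun _ _ _ ↦ Units.ext (by
    rw [Units.val_mul, he', he', he', hadd₂])
  have hanti' : ∀ S T, e' (τ S) (τ T) = (e' S T)⁻¹ := fun S T ↦ Units.ext (by
    rw [Units.val_inv_eq_inv_val, he', he', hτ, hτ]
    exact weilPairing_conj_conj_eq_inv hM hc₀ e hμ hgal S T)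
  let B : geomTorsion W ((2 ^ M : ℕ) : ℤ) →+ geomTorsion W ((2 ^ M : ℕ) : ℤ) →+ Additive (AlgebraicClosure ℚ)ˣ :=
    AddMonoidHom.mk' (fun S ↦ AddMonoidHom.mk' (fun T ↦ Additive.ofMul (e' S T)) (fun T₁ T₂ ↦ by
      rw [hadd₂']; rfl)) (fun S₁ S₂ ↦ by
        ext T
        simp only [AddMonoidHom.mk'_apply, AddMonoidHom.add_apply, hadd₁']
        rfl)
  have hB : ∀ S T, B S T = Additive.ofMul (e' S T) := fun _ _ ↦ rfl
  have hanti : ∀ S T, B (τ S) (τ T) = -B S T := fun S T ↦ by rw [hB, hB, hanti']; rfl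
  have key := pairing_eq_zero_of_same_sign τ hττ B hanti P₀ hspan hfree htor
  have hread : ∀ S T, B S T = 0 → e S T = 1 := fun S T h ↦ by
    rw [hB] at h
    have h' : e' S T = 1 := ofMul_eq_zero.mp h
    have h'' := congrArg Units.val h'
    rw [Units.val_one] at h''
    exact h''
  exact ⟨fun x x' hx hx' ↦ hread _ _ (key.1 x x' hx hx'), fun y y' hy hy' ↦ hread _ _ (key.2 y y' hy hy')⟩

end Summit.BirchSwinnertonDyer.BirchSwinnertonDyer.Theorems.GenusExact.PlusDescent

end
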